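import Mathlib
import HarnessLib
import Literature.Geometry.DiscreteGeometry.BondGraph
import Literature.MathematicalPhysics.StatisticalMechanics.BarlowStacking
import Summits.AtomisticToContinuum.Crystallization.Theses.PricedLinkCensus
import Summits.AtomisticToContinuum.Crystallization.Theorems.PricedLinkCensusSoftLayerPropagationBasics

/-!
# `SoftLayerPropagation` splits into a COMBINATORIAL labelling and a METRIC licence

Route `PricedLinkCensus`, crux `SoftLayerPropagation` (stmt-AtomisticToContinuum-14233).
Crux-strategist decomposition (planner, 2026-08-17): the crux

  `SoftLayerPropagation` = charge-free at `η ≤ 1/100` on the `8·nn_i`-ball ⇒ the `3·nn_i`-ball is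
  `(nn_i/6)`-matched both ways to a rigid image of `barlowStacking nn_i (nn_i √(2/3)) s`

follows from two typed pieces, each strictly smaller than the crux:

* **`BarlowBallLabelling`** (combinatorial half, tolerance-free conclusion).  Under the crux
  hypothesis there are a Hägg sequence `s` and LABELS `L : Fin N → ℝ³` such that on the real
  `(7/2)·nn_i`-ball: every label of the real `3·nn_i`-ball lies in the UNIT stacking `barlowStacking 1 √(2/3) s`; labels are
  injective; bonds of the scale-free bond graph are EXACTLY the pairs at label distance `1`; and
  every stacking point within `19/6` of the centre's label `L i` is the label of a site of the
  ball (coverage).  No metric constant appears: which sites form layers, where the h-layers are,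
  the Hägg word and the exclusion of a second twin family are decided here, at radius `8 → 7/2`.
* **`LabelledLicence`** (metric half, the sharp constant).  GIVEN such a labelling (and the
  charge-free `8·nn_i`-ball), ONE rigid motion `g` puts `y j` within `nn_i/6` of
  `g (nn_i • L j)` for every site `j` of the `(7/2)·nn_i`-ball that the crux inspects (real distance
  `≤ 3·nn_i`, or label within `19/6` of `L i`).  This is the discrete Liouville / rigidity
  inequality whose constant must be sharp within a factor ≈ 1.5 (disprover: `¬ SLP 8 3 (1/20)`,
  uniform `2 %` strain gives deviation `0.056·nn`; lead numerics: worst `≈ 0.108·nn`).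

`SoftLayerPropagation_of_subs : BarlowBallLabelling → LabelledLicence → SoftLayerPropagation`
is the glue, proved here (bookkeeping: positivity of `nn_i` at a charge-free site and the scaling
`barlowStacking nn (nn √(2/3)) s = nn • barlowStacking 1 √(2/3) s`, both from
`Theorems/PricedLinkCensusSoftLayerPropagationBasics.lean`).  The two hypotheses are written out
VERBATIM as the statements of the route items `BarlowBallLabelling`, `LabelledLicence` filed by
`ledger route edit --split SoftLayerPropagation`.

No new definitions. [folklore]
-/

noncomputable section

namespace Summit.AtomisticToContinuum.Crystallization.Theorems

open Literature.Geometry.DiscreteGeometry Literature.MathematicalPhysics.StatisticalMechanics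

/-- **The crux from its two halves.**  Hypothesis 1 (`BarlowBallLabelling`): an injective,
bond-faithful labelling of the real `(7/2)·nn_i`-ball by points of a unit Barlow stacking, covering
the stacking's `19/6`-ball about the centre's label.  Hypothesis 2 (`LabelledLicence`): for every
such labelling one rigid motion is `nn_i/6`-accurate on the sites with real distance `≤ 3·nn_i`
or label distance `≤ 19/6`.  Conclusion: `PricedLinkCensus.SoftLayerPropagation`.

Proof: take `s, L` from (1) and `g` from (2); a site `j` of the `3·nn_i`-ball is matched to
`z := nn_i • L j ∈ barlowStacking nn_i (nn_i √(2/3)) s`; conversely a stacking point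
`nn_i • x` within `3·nn_i` of `y i` has `dist x (L i) ≤ 3 + 1/6 = 19/6` (the centre itself is
matched), so `x = L j` for a site `j` of the `(7/2)·nn_i`-ball by coverage, and `j` is matched. -/
theorem SoftLayerPropagation_of_subs :
    (∀ η : ℝ, 0 < η → η ≤ 1 / 100 →
      ∀ (N : ℕ) (y : Fin N → EuclideanSpace ℝ (Fin 3)) (i : Fin N),
        (∀ j : Fin N, dist (y i) (y j) ≤ 8 * Literature.Geometry.DiscreteGeometry.nearestDist y i →
          Literature.Geometry.DiscreteGeometry.IsChargeFree η y j) →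
        ∃ (s : ℤ → ℤ) (L : Fin N → EuclideanSpace ℝ (Fin 3)),
          Literature.MathematicalPhysics.StatisticalMechanics.IsHaggSeq s ∧
          (∀ j : Fin N, dist (y i) (y j) ≤ 3 * Literature.Geometry.DiscreteGeometry.nearestDist y i →
            L j ∈ Literature.MathematicalPhysics.StatisticalMechanics.barlowStacking 1 (Real.sqrt (2 / 3)) s) ∧
          (∀ j k : Fin N, dist (y i) (y j) ≤ 7 / 2 * Literature.Geometry.DiscreteGeometry.nearestDist y i →
            dist (y i) (y k) ≤ 7 / 2 * Literature.Geometry.DiscreteGeometry.nearestDist y i → L j = L k → j = k) ∧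
          (∀ j k : Fin N, dist (y i) (y j) ≤ 7 / 2 * Literature.Geometry.DiscreteGeometry.nearestDist y i →
            dist (y i) (y k) ≤ 7 / 2 * Literature.Geometry.DiscreteGeometry.nearestDist y i →
            ((Literature.Geometry.DiscreteGeometry.bondGraph η y).Adj j k ↔ dist (L j) (L k) = 1)) ∧
          (∀ z ∈ Literature.MathematicalPhysics.StatisticalMechanics.barlowStacking 1 (Real.sqrt (2 / 3)) s,
            dist z (L i) ≤ 19 / 6 →
            ∃ j : Fin N, dist (y i) (y j) ≤ 7 / 2 * Literature.Geometry.DiscreteGeometry.nearestDist y i ∧ L j = z)) →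
    (∀ η : ℝ, 0 < η → η ≤ 1 / 100 →
      ∀ (N : ℕ) (y : Fin N → EuclideanSpace ℝ (Fin 3)) (i : Fin N),
        (∀ j : Fin N, dist (y i) (y j) ≤ 8 * Literature.Geometry.DiscreteGeometry.nearestDist y i →
          Literature.Geometry.DiscreteGeometry.IsChargeFree η y j) →
        ∀ (s : ℤ → ℤ) (L : Fin N → EuclideanSpace ℝ (Fin 3)),
          Literature.MathematicalPhysics.StatisticalMechanics.IsHaggSeq s →
          (∀ j : Fin N, dist (y i) (y j) ≤ 3 * Literature.Geometry.DiscreteGeometry.nearestDist y i →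
            L j ∈ Literature.MathematicalPhysics.StatisticalMechanics.barlowStacking 1 (Real.sqrt (2 / 3)) s) →
          (∀ j k : Fin N, dist (y i) (y j) ≤ 7 / 2 * Literature.Geometry.DiscreteGeometry.nearestDist y i →
            dist (y i) (y k) ≤ 7 / 2 * Literature.Geometry.DiscreteGeometry.nearestDist y i → L j = L k → j = k) →
          (∀ j k : Fin N, dist (y i) (y j) ≤ 7 / 2 * Literature.Geometry.DiscreteGeometry.nearestDist y i →
            dist (y i) (y k) ≤ 7 / 2 * Literature.Geometry.DiscreteGeometry.nearestDist y i →
            ((Literature.Geometry.DiscreteGeometry.bondGraph η y).Adj j k ↔ dist (L j) (L k) = 1)) →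
          (∀ z ∈ Literature.MathematicalPhysics.StatisticalMechanics.barlowStacking 1 (Real.sqrt (2 / 3)) s,
            dist z (L i) ≤ 19 / 6 →
            ∃ j : Fin N, dist (y i) (y j) ≤ 7 / 2 * Literature.Geometry.DiscreteGeometry.nearestDist y i ∧ L j = z) →
          ∃ g : EuclideanSpace ℝ (Fin 3) ≃ᵃⁱ[ℝ] EuclideanSpace ℝ (Fin 3),
            ∀ j : Fin N, dist (y i) (y j) ≤ 7 / 2 * Literature.Geometry.DiscreteGeometry.nearestDist y i →
              (dist (y i) (y j) ≤ 3 * Literature.Geometry.DiscreteGeometry.nearestDist y i ∨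
                dist (L j) (L i) ≤ 19 / 6) →
              dist (y j) (g (Literature.Geometry.DiscreteGeometry.nearestDist y i • L j)) ≤
                Literature.Geometry.DiscreteGeometry.nearestDist y i / 6) →
    Summit.AtomisticToContinuum.Crystallization.Theses.PricedLinkCensus.SoftLayerPropagation := by
  intro hLab hLic
  unfold Summit.AtomisticToContinuum.Crystallization.Theses.PricedLinkCensus.SoftLayerPropagation
  intro η hη hη1 N y i hcf
  -- the centre is charge-free, hence has positive scale
  have hpos : 0 < nearestDist y i := nearestDist_pos_of_ball_chargeFree hcf
  -- the combinatorial half: labels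
  obtain ⟨s, L, hs, hmem, hinj, hbond, hcov⟩ := hLab η hη hη1 N y i hcf
  -- the metric half: one rigid motion
  obtain ⟨g, hg⟩ := hLic η hη hη1 N y i hcf s L hs hmem hinj hbond hcov
  refine ⟨s, g, hs, ?_, ?_⟩
  · -- every site of the `3·nn_i`-ball is within `nn_i/6` of its rescaled label
    intro j hj
    have hj4 : dist (y i) (y j) ≤ 7 / 2 * nearestDist y i := by
      have h34 : 3 * nearestDist y i ≤ 7 / 2 * nearestDist y i := by nlinarith
      exact hj.trans h34
    exact ⟨nearestDist y i • L j, smul_mem_barlowStacking (hmem j hj), hg j hj4 (Or.inl hj)⟩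
  · -- every stacking point of the `3·nn_i`-ball is within `nn_i/6` of a site
    intro z hz hzi
    obtain ⟨x, hx, rfl⟩ := exists_eq_smul_of_mem_barlowStacking hz
    -- the centre itself is matched, so `x` is within `19/6` of `L i`
    have hi4 : dist (y i) (y i) ≤ 7 / 2 * nearestDist y i := by
      rw [dist_self]; positivity
    have hi3 : dist (y i) (y i) ≤ 3 * nearestDist y i := by
      rw [dist_self]; positivity
    have hgi := hg i hi4 (Or.inl hi3)
    have hdist : dist (nearestDist y i • x) (nearestDist y i • L i) =
        nearestDist y i * dist x (L i) := by
      rw [dist_smul₀, Real.norm_eq_abs, abs_of_pos hpos]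
    have hx13 : dist x (L i) ≤ 19 / 6 := by
      have h1 : dist (g (nearestDist y i • x)) (g (nearestDist y i • L i)) ≤
          dist (g (nearestDist y i • x)) (y i) + dist (y i) (g (nearestDist y i • L i)) :=
        dist_triangle _ _ _
      rw [AffineIsometryEquiv.dist_map, hdist, dist_comm (g (nearestDist y i • x)) (y i)] at h1
      have h3 : nearestDist y i * dist x (L i) ≤ nearestDist y i * (19 / 6) := by linarith
      exact le_of_mul_le_mul_left h3 hpos
    obtain ⟨j, hj4, hjx⟩ := hcov x hx hx13
    refine ⟨j, ?_⟩
    have hlab : dist (L j) (L i) ≤ 19 / 6 := by rw [hjx]; exact hx13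
    have := hg j hj4 (Or.inr hlab)
    rwa [hjx] at this

end Summit.AtomisticToContinuum.Crystallization.Theorems

end
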